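import Summits.FinalStateConjecture.FinalStateConjecture.Theses.PhotonSphereChannels
import Summits.FinalStateConjecture.FinalStateConjecture.Theses.EternalPapapetrou
import Literature.Geometry.Lorentzian.SpacetimeLocalConvergence
import Literature.Geometry.Lorentzian.Stationary
import Literature.Geometry.Lorentzian.RedShiftedHorizon
import Literature.Geometry.Lorentzian.LorentzianDistance
-- scratch check against the landed Negative lemmas of this crux (cdisprove; they concern K1's 1+1
-- Regge–Wheeler channel energies — `rw_channelEnergy_le` & co. — and no stub below is an instance):
import Summits.FinalStateConjecture.FinalStateConjecture.Theorems.ChannelsResolveTameDevelopments.Negative.ExteriorEnergyAntitone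

/-!
# Line `limit-bifurcation-sphere-hawking-collar` for crux
`PhotonSphereChannels.ChannelsResolveTameDevelopments` (stmt-FinalStateConjecture-10046)

Skeleton (crux-plan, planner-cruxplan-stmt-FinalStateConjecture-10046-limit-bifurcation-sp-0,
2026-08-16).  Direction POSITIVE.  See the line card `Lines/limit-bifurcation-sphere-hawking-collar.md`.

The crux is literally `K1 → Φ` with `K1 = UniformPhotonSphereChannels` (refuted on paper, standing
disprover's `Disproof.lean`: `channelsResolve_iff`, `of_tameResolution`, `channelsResolve_of_F12`) and
`Φ = TameResolution` (conditional soliton resolution for vacuum exteriors: complete `𝓘⁺` +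
(i) no extremal-Kerr remnant + (ii) uniformly `C³`-bounded, `C⁰`-pinched outer geometry ⇒ an honest
exhaustive `FinalStateDecomposition`).  This line proves `Φ` OUTRIGHT (it never uses `K1`, so it
survives the route's declared pivot of `K1` verbatim) by the ω-limit / LaSalle architecture of the
idea card, whose lever is:

> an ETERNAL, two-sidedly TAME, RED-SHIFTED, non-expanding vacuum horizon is the Killing horizon of
> a Killing field living on an (early) collar — the `e^{-kκs}` transversal transients are killed by
> two-sided boundedness, the boost-renormalised past completion of the limit is a regular BIFURCATE
> non-expanding horizon, and Alexakis–Ionescu–Klainerman's Hawking rigidity WITHOUT analyticity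
> (arXiv:0902.1173, Thm 1.1) hands the limit a horizon Killing field `K` near its (virtual)
> bifurcation sphere.

THE LINE (seven registered stubs; the intermediate currency is the bundled ω-limit object
`TameEternalLimit` defined below over existing declarations):

* `stub_omegaLimits` — STRUCTURE OF ω-LIMITS: under (ii) + complete `𝓘⁺` + maximality, along every
  escaping sequence of base points of the outer region the development subconverges in pointed
  `C²_loc` WITH eternal far charts (`Spacetime.SubconvergesLocallyWithFarChartsTo`) to a
  `TameEternalLimit`: a smooth, Ricci-flat, globally hyperbolic spacetime carried by an eternal far
  chart with `1/r` bounds and two-sided non-radiation at order `1/r`, `C^k`-tame for EVERY `k` in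
  charts adapted to a global clock, whose event horizon (of the far end) is empty or a complete,
  non-expanding, shear-free null hypersurface generated by a clock-normalised field `L`.
  (Absorbs triage X2 — regularity is asked of the LIMIT, where it is consumed — and X3 — the horizon
  area bound behind non-expansion.)
* `stub_kappaFloor` — (i) ⇒ the limit horizon is RED-SHIFTED in the tame clock (`∇_L L = κL`,
  `κ ≥ κ₀ > 0`).  (Triage X1, stated as the honest open step it is.)
* `stub_killingCollar` — THE LEVER: a red-shifted `TameEternalLimit` carries a Killing field on an
  open neighbourhood of an EARLY portion `{t < t₁}` of its horizon, positively proportional to `L`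
  there (AIK at the limit bifurcation sphere; triage: early collar only).
* `stub_farZoneEternalPapapetrou` — literally the typed crux `FarZoneEternalPapapetrou` of route
  `EternalPapapetrou` (stmt-FinalStateConjecture-10034, shared staffing): far-zone stationarity of
  eternal non-radiating far charts.  Applied to the limit's far chart by `farStationary_of` (proved).
* `stub_collarHandshake` — black-hole branch: horizon nonempty + early Killing collar `K` + far
  stationary `T` + red-shift ⇒ the closure of the limit's d.o.c. is covered by an isometric copy of a
  horizon-penetrating SUB-EXTREMAL Kerr region (two one-sided Killing fields continued towards each
  other on early slabs; `span{T,K}` ⇒ axisymmetric ⇒ Kerr, or `T = K` ⇒ static ⇒ Schwarzschild; then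
  Cauchy stability inside the globally hyperbolic limit).
* `stub_noTameGeon` — horizonless branch: empty horizon + far stationary `T` ⇒ the limit is flat
  (the shared "no tame vacuum geon" input; NOT this line's mechanism — cf. stmt-10745's complete case).
* `stub_tameEndgame` — the frame: if every escaping sequence of the outer region has such a limit
  which is a Kerr black hole or flat, then the honest exhaustive `FinalStateDecomposition` with
  `O = exteriorOf 𝒟 d.charted` exists (parameters freeze by the Bondi/area budgets, motions are
  inertial, horizon-anchored charts, `C²` convergence from the `C²_loc` convergence of translates).

Composition (sorry-free): `tameResolution_of : S1 → … → S7 → TameResolution` and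
`ChannelsResolveTameDevelopments_of : S1 → … → S7 → ChannelsResolveTameDevelopments` (the crux BY
NAME; `K1` is discarded: `fun _ ↦ Φ`, exactly `Disproof.of_tameResolution`).

Disproof.lean honoured (cdisprove cycles 1–2, 2026-08-15): no `_false_without_<H>` theorem exists for
this crux; the landed Negative lemmas (`Negative/ExteriorEnergyAntitone`, `WaveSliceCalculus`,
`ShrinkingIntervalEnergy`) concern `K1`'s 1+1 channel energies and no stub below is an instance of
them (nothing here mentions Regge–Wheeler channels).  `TameResolution` below is verbatim the
disprover's `Φ`.  Negatives index (`ledger negatives --problem FinalStateConjecture`): empty.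
Hypothesis ledger for future `_false_without_` theorems: (ii) is used in S1, S2, S7; (i) ONLY in S2;
complete `𝓘⁺` in S1 (area theorem ⇒ non-expanding limit horizons; Bondi budget ⇒ no news) and S7;
maximality in S1 (limit d.o.c. globally hyperbolic) and S7 (`O = exteriorOf`).
-/

set_option linter.dupNamespace false
set_option linter.unusedVariables false

noncomputable section

namespace Summit.FinalStateConjecture.FinalStateConjecture.Cruxes.ChannelsResolveTameDevelopments.LimitBifurcationSphereHawkingCollar

open Summit.FinalStateConjecture.FinalStateConjecture.Theses.PhotonSphereChannels
open Summit.FinalStateConjecture.FinalStateConjecture.Theses.EternalPapapetrou (FarZoneEternalPapapetrou)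
open Literature.Geometry.Lorentzian
open scoped Manifold ContDiff Topology ENNReal NNReal
open Filter Set Function TopologicalSpace

/-! ## §0 The refutable content `Φ` of the crux and the logical bridge -/

/-- **`Φ` = `TameResolution`**, the consequent of `ChannelsResolveTameDevelopments`, verbatim (the
crux is `UniformPhotonSphereChannels → TameResolution` by `Iff.rfl`; this is also the standing
disprover's `Disproof.TameResolution`).  For every admissible datum and every MGHD with complete
`𝓘⁺` such that (i) no late-time chart `C²`-converges to a boosted EXTREMAL Kerr exterior on all
near-zone slabs and (ii) the outer region has uniformly `C³`-bounded, `C⁰`-pinched geometry in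
coordinate balls of a fixed radius, there is an honest `2`-decomposition `d` with
`O = exteriorOf 𝒟 d.charted` and `HasExhaustiveCharts d`. [cite: DafermosLuk2017, Conjecture 1 and §1.2.1] -/
def TameResolution : Prop :=
  ∀ (X : Type) [TopologicalSpace X] [ChartedSpace Literature.Geometry.Lorentzian.E3 X] [IsManifold (modelWithCornersSelf ℝ Literature.Geometry.Lorentzian.E3) ((⊤ : ℕ∞) : WithTop ℕ∞) X] [T2Space X] [SecondCountableTopology X] [ConnectedSpace X], ∀ D ∈ Literature.Geometry.Lorentzian.admissibleVacuumData X, ∀ 𝒟 : Literature.Geometry.Lorentzian.VacuumCauchyDevelopment D, 𝒟.IsMaximal → _root_.Summit.FinalStateConjecture.HasCompleteNullInfinity 𝒟.toCauchyDevelopment → ((∀ (Λ : Literature.Geometry.Lorentzian.lorentzGroup) (c : Literature.Geometry.Lorentzian.E4) (M a : ℝ), Literature.Geometry.Lorentzian.Kerr.IsExtremal M a → ¬ ∃ (τ₀ : ℝ) (Ψ : (Literature.Geometry.Lorentzian.boostedKerrBackground Λ c M a).domain → 𝒟.carrier), 𝒟.toSpacetime.IsLateChart (Literature.Geometry.Lorentzian.boostedKerrBackground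 Λ c M a) Set.univ τ₀ Ψ ∧ ∀ R : ℝ, Filter.Tendsto (fun τ => 𝒟.toSpacetime.truncDeviationCk (Literature.Geometry.Lorentzian.boostedKerrBackground Λ c M a) Ψ 2 R τ) Filter.atTop (nhds 0)) ∧ ∀ [𝒟.metric.HasLeviCivita], let outer : Set 𝒟.carrier := 𝒟.metric.causalFuture 𝒟.timeOrientation (Set.range 𝒟.embed) ∩ {q | ∃ (p : X) (γ : ℝ → 𝒟.carrier) (dom : Set ℝ), 𝒟.metric.IsNormalisedNullRayFrom 𝒟.timeOrientation 𝒟.embed 𝒟.normal p γ dom ∧ ¬ BddAbove dom ∧ q ∈ 𝒟.metric.chronologicalPast 𝒟.timeOrientation (γ '' (dom ∩ Set.Ici 0))}; ∃ r₀ : ℝ, 0 < r₀ ∧ ∃ Λ : NNReal, ∀ q ∈ outer, let U : TopologicalSpace.Opens Literature.Geometry.Lorentzian.E4 := ⟨Metric.ball (0 : Literature.Geometry.Lorentzian.E4) r₀, Metric.isOpen_ball⟩; ∃ Ψ : U → 𝒟.carrier, 𝒟.toSpacetime.IsLateChart (Literature.Geometry.Lorentzian.Minkowski.backgroundOn U)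 Set.univ (-r₀) Ψ ∧ (∃ x : U, (x : Literature.Geometry.Lorentzian.E4) = 0 ∧ Ψ x = q) ∧ Literature.Geometry.Lorentzian.supCkENorm (U : Set Literature.Geometry.Lorentzian.E4) 3 (𝒟.toSpacetime.deviationExtend (Literature.Geometry.Lorentzian.Minkowski.backgroundOn U) Ψ) ≤ (Λ : ENNReal) ∧ Literature.Geometry.Lorentzian.supCkENorm (U : Set Literature.Geometry.Lorentzian.E4) 0 (𝒟.toSpacetime.deviationExtend (Literature.Geometry.Lorentzian.Minkowski.backgroundOn U) Ψ) ≤ 1 / 2) → ∃ (O : Set 𝒟.carrier) (d : Literature.Geometry.Lorentzian.FinalStateDecomposition 𝒟.toSpacetime O 2), O = _root_.Summit.FinalStateConjecture.exteriorOf 𝒟.toCauchyDevelopment d.charted ∧ _root_.Summit.FinalStateConjecture.HasExhaustiveCharts d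

/-- The crux is literally `K1 → Φ`. [folklore] -/
theorem channelsResolve_iff :
    ChannelsResolveTameDevelopments ↔ (UniformPhotonSphereChannels → TameResolution) :=
  Iff.rfl

/-- `Φ` alone implies the crux (`K1` is a proof hint, not a logical input; `Disproof.of_tameResolution`). [folklore] -/
theorem channelsResolve_of_tameResolution (hΦ : TameResolution) : ChannelsResolveTameDevelopments :=
  fun _ ↦ hΦ

/-! ## §1 Vocabulary of the line (all over existing declarations)

The two hypotheses of `Φ` as named predicates (verbatim bodies), the outer region, escaping
sequences, clock-adapted tame charts, the far background, and the bundled ω-limit object. -/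

section Vocabulary

variable {X : Type} [TopologicalSpace X] [ChartedSpace Literature.Geometry.Lorentzian.E3 X]
  [IsManifold (modelWithCornersSelf ℝ Literature.Geometry.Lorentzian.E3) ((⊤ : ℕ∞) : WithTop ℕ∞) X]
  [ConnectedSpace X] {D : Literature.Geometry.Lorentzian.InitialDataSet (modelWithCornersSelf ℝ Literature.Geometry.Lorentzian.E3) X}

/-- Hypothesis (i) of `Φ`, verbatim: **no extremal remnant** — no late-time chart from a boosted
extremal Kerr exterior along which the `C²` deviation tends to `0` on every near-zone slab.
[cite: DafermosLuk2017, Conjecture 1] -/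
def NoExtremalRemnant (𝒟 : Literature.Geometry.Lorentzian.VacuumCauchyDevelopment D) : Prop :=
  ∀ (Λ : Literature.Geometry.Lorentzian.lorentzGroup) (c : Literature.Geometry.Lorentzian.E4) (M a : ℝ), Literature.Geometry.Lorentzian.Kerr.IsExtremal M a → ¬ ∃ (τ₀ : ℝ) (Ψ : (Literature.Geometry.Lorentzian.boostedKerrBackground Λ c M a).domain → 𝒟.carrier), 𝒟.toSpacetime.IsLateChart (Literature.Geometry.Lorentzian.boostedKerrBackground Λ c M a) Set.univ τ₀ Ψ ∧ ∀ R : ℝ, Filter.Tendsto (fun τ => 𝒟.toSpacetime.truncDeviationCk (Literature.Geometry.Lorentzian.boostedKerrBackground Λ c M a) Ψ 2 R τ) Filter.atTop (nhds 0)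

/-- Hypothesis (ii) of `Φ`, verbatim: **the outer region is uniformly `C³`-tame** (bounded geometry
in `C⁰`-pinched coordinate balls of a fixed radius `r₀` about every point of
`J⁺(Σ) ∩ ⋃ I⁻(future branches of future-complete normalised null rays from Σ)`).
[cite: DafermosLuk2017, §1.2.1] -/
def TameOuterRegion (𝒟 : Literature.Geometry.Lorentzian.VacuumCauchyDevelopment D) : Prop :=
  ∀ [𝒟.metric.HasLeviCivita], let outer : Set 𝒟.carrier := 𝒟.metric.causalFuture 𝒟.timeOrientation (Set.range 𝒟.embed) ∩ {q | ∃ (p : X) (γ : ℝ → 𝒟.carrier) (dom : Set ℝ), 𝒟.metric.IsNormalisedNullRayFrom 𝒟.timeOrientation 𝒟.embed 𝒟.normal p γ dom ∧ ¬ BddAbove dom ∧ q ∈ 𝒟.metric.chronologicalPast 𝒟.timeOrientation (γ '' (dom ∩ Set.Ici 0))}; ∃ r₀ : ℝ, 0 < r₀ ∧ ∃ Λ : NNReal, ∀ q ∈ outer, let U : TopologicalSpace.Opens Literature.Geometry.Lorentzian.E4 := ⟨Metric.ball (0 : Literature.Geometry.Lorentzian.E4) r₀, Metric.isOpen_ball⟩;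 ∃ Ψ : U → 𝒟.carrier, 𝒟.toSpacetime.IsLateChart (Literature.Geometry.Lorentzian.Minkowski.backgroundOn U) Set.univ (-r₀) Ψ ∧ (∃ x : U, (x : Literature.Geometry.Lorentzian.E4) = 0 ∧ Ψ x = q) ∧ Literature.Geometry.Lorentzian.supCkENorm (U : Set Literature.Geometry.Lorentzian.E4) 3 (𝒟.toSpacetime.deviationExtend (Literature.Geometry.Lorentzian.Minkowski.backgroundOn U) Ψ) ≤ (Λ : ENNReal) ∧ Literature.Geometry.Lorentzian.supCkENorm (U : Set Literature.Geometry.Lorentzian.E4) 0 (𝒟.toSpacetime.deviationExtend (Literature.Geometry.Lorentzian.Minkowski.backgroundOn U) Ψ) ≤ 1 / 2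

/-- The **outer region** `J⁺(Σ) ∩ ⋃ I⁻(future branch of a future-complete normalised null ray
from Σ)` of a Cauchy development (the set `outer` of hypothesis (ii); it contains the domain of outer
communications). [cite: DafermosLuk2017, §1.2.1] -/
def outerRegion (𝒟 : Literature.Geometry.Lorentzian.CauchyDevelopment D) [𝒟.metric.HasLeviCivita] :
    Set 𝒟.carrier :=
  𝒟.metric.causalFuture 𝒟.timeOrientation (Set.range 𝒟.embed) ∩ {q | ∃ (p : X) (γ : ℝ → 𝒟.carrier) (dom : Set ℝ), 𝒟.metric.IsNormalisedNullRayFrom 𝒟.timeOrientation 𝒟.embed 𝒟.normal p γ dom ∧ ¬ BddAbove dom ∧ q ∈ 𝒟.metric.chronologicalPast 𝒟.timeOrientation (γ '' (dom ∩ Set.Ici 0))}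

/-- A sequence of events `p : ℕ → M` of a Cauchy development **escapes to the future**: its
time-separation (Lorentzian distance, `Spacetime.lorentzDist`) from the Cauchy hypersurface `ι(X)`
tends to `+∞` — for every `T`, eventually some point of `ι(X)` lies at time-separation `≥ T` to the
past of `p n`.  These are the base-point sequences along which late-time ω-limits are taken.
[cite: ONeillSemiRiemannian1983, Ch. 14, Def. 14.15 (p. 409)] -/
def IsEscaping (𝒟 : Literature.Geometry.Lorentzian.CauchyDevelopment D) (p : ℕ → 𝒟.carrier) : Prop :=
  ∀ T : ℝ, ∀ᶠ n in Filter.atTop, ∃ x : X, ENNReal.ofReal T ≤ 𝒟.toSpacetime.lorentzDist (𝒟.embed x) (p n)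

end Vocabulary

/-- A **`C^k`-tame chart at `q` adapted to the clock `t`** of the spacetime `𝓢`: the per-point clause
of hypothesis (ii) with `3 ↦ k` — a smooth late chart `Ψ` of the Minkowski background on the
coordinate ball `B(0, r₀) ⊆ E4`, centred at `q` (`Ψ 0 = q`), with `‖Ψ^* g − η‖_{C^k(B)} ≤ Λ` and
`‖Ψ^* g − η‖_{C⁰(B)} ≤ 1/2` — IN WHICH THE CLOCK IS COORDINATE TIME: `t (Ψ x) = t q + x⁰`.  The last
clause is the triage-demanded tie between the red-shift clock and the tame charts (with a free clock
the surface gravity of a dynamical horizon is a free reparametrisation, `RedShiftedHorizon.lean`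
module docstring); since `Ψ^* g` is `C⁰`-pinched to `η`, `x⁰` — hence `t` — is a time function with
uniformly timelike, uniformly bounded gradient. [cite: arXiv210408222, §1] [cite: DafermosRodnianski2008, §7.1] -/
def TameClockChartAt (𝓢 : Literature.Geometry.Lorentzian.Spacetime.{0} 4) (t : 𝓢.carrier → ℝ) (k : ℕ)
    (r₀ : ℝ) (Λ : NNReal) (q : 𝓢.carrier) : Prop :=
  let U : TopologicalSpace.Opens Literature.Geometry.Lorentzian.E4 := ⟨Metric.ball (0 : Literature.Geometry.Lorentzian.E4) r₀, Metric.isOpen_ball⟩; ∃ Ψ : U → 𝓢.carrier, 𝓢.IsLateChart (Literature.Geometry.Lorentzian.Minkowski.backgroundOn U) Set.univ (-r₀) Ψ ∧ (∃ x : U, (x : Literature.Geometry.Lorentzian.E4) = 0 ∧ Ψ x = q) ∧ Literature.Geometry.Lorentzian.supCkENorm (U : Set Literature.Geometry.Lorentzian.E4) k (𝓢.deviationExtend (Literature.Geometry.Lorentzian.Minkowski.backgroundOn U) Ψ) ≤ (Λ : ENNReal) ∧ Literature.Geometry.Lorentzian.supCkENorm (U : Set Literature.Geometry.Lorentzian.E4)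 0 (𝓢.deviationExtend (Literature.Geometry.Lorentzian.Minkowski.backgroundOn U) Ψ) ≤ 1 / 2 ∧ ∀ x : U, t (Ψ x) = t q + (x : Literature.Geometry.Lorentzian.E4) 0

/-- The **eternal far background** `(ℝ_t × {|x| > R}, g_{M,0}, x⁰, |x|)`: the cylinder
`Kerr.region 0 R` with the ingoing Kerr–Schild (Eddington–Finkelstein) Schwarzschild form of mass
`M` — exactly the `let B` of `FarZoneEternalPapapetrou` (stmt-10034). [cite: arXiv08110354, §5.1] -/
def farBackground (M R : ℝ) : Literature.Geometry.Lorentzian.ModelBackground :=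
  ⟨Literature.Geometry.Lorentzian.Kerr.region 0 R, Literature.Geometry.Lorentzian.Kerr.bilin M 0, fun x ↦ x 0, Literature.Geometry.Lorentzian.Kerr.radius 0⟩

/-- **The ω-limit object of the line: a tame eternal limit.**  A smooth time-oriented Lorentzian
`4`-manifold `Z` with a base point `z`, carried by

* an ETERNAL FAR CHART `Φ : ℝ_t × {|x| > R} → Z` (injective local diffeomorphism) in which the
  deviation `h = Φ^* g − g_{M,0}` from Schwarzschild of mass `M ≥ 0` obeys `‖D^m h‖·r ≤ C_k` for all
  `m ≤ k`, for EVERY `k`, uniformly in `t ∈ ℝ`, and is TWO-SIDED NON-RADIATING at order `1/r`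
  (`r‖D^m ∂₀h‖ → 0` as `r → ∞` uniformly in `t`, every `m`) — verbatim the hypotheses of
  `FarZoneEternalPapapetrou` at every order;
* a smooth global CLOCK `t : Z → ℝ` equal to far-chart time on the far zone;
* `C^k`-TAMENESS FOR EVERY `k` in clock-adapted charts (`TameClockChartAt`) about every point of the
  closure of the domain of outer communications `⟨⟨Φ⟩⟩ = I⁺(range Φ) ∩ I⁻(range Φ)` of the far end;
* the vacuum equations, global hyperbolicity, `Z ⊆ I⁺(range Φ)` (no white-hole junk), and
  `z ∈ closure ⟨⟨Φ⟩⟩`;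
* HORIZON STRUCTURE: the future event horizon `𝓗 = ∂I⁻(range Φ) ∩ I⁺(range Φ)` of the far end
  (`Spacetime.futureEventHorizonOfEnd`; possibly EMPTY — the horizonless/dispersive limits) is
  generated by a vector field `L`, smooth near `𝓗`, future-directed null on `𝓗`, normalised by the
  clock `dt(L) = 1`, tangent to `𝓗` (whole-line integral curves starting on `𝓗` stay on `𝓗`),
  COMPLETE on `𝓗` (through every horizon point passes a whole-line integral curve: the horizon is
  eternal, its generators have no past end points in `Z`, no creases), REGULAR (`𝓗` is the zero set
  of a smooth function `f` on a neighbourhood, with `ker df_p = L_p^⊥` at horizon points: a smooth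
  embedded NULL hypersurface with null normal `L`), with COMPACT clock-sections `𝓗 ∩ {t = c}`, and
  NON-EXPANDING & SHEAR-FREE (`g(∇_Y L, W) + g(Y, ∇_W L) = 0` for `Y, W ⊥ L`, i.e. tangent, at
  horizon points).  (Triage r1-1/r1-2: these clauses exclude the single-geodesic / sandwich-wave
  junk instances of the card's first lemma — `𝓗` is the genuine event horizon of an asymptotically
  flat far end.)

The surface gravity of `L` is NOT part of the structure (it is the output of `stub_kappaFloor`).
These are exactly the inputs the lever consumes; `stub_omegaLimits` asserts that late-time limits of
tame developments can be so packaged.  (Cheeger–Gromov limits: Petersen 2006, Ch. 10 §3.2; d.o.c. /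
event horizon of an end: Chruściel–Costa 2008, (2.2)–(2.5); non-expanding horizons:
Ashtekar–Beetle–Lewandowski gr-qc/0111067, §2.) [cite: Petersen2006, Ch. 10 §3.2] -/
structure TameEternalLimit where
  /-- The limit spacetime. -/
  Z : Literature.Geometry.Lorentzian.Spacetime.{0} 4
  /-- The base point of the pointed limit. -/
  z : Z.carrier
  /-- The Schwarzschild mass parameter of the far chart (`M = 0` for dispersive limits). -/
  M : ℝ
  /-- The inner radius of the far chart. -/
  R : ℝ
  /-- The eternal far chart on the cylinder `ℝ_t × {|x| > R}`. -/
  Φ : Literature.Geometry.Lorentzian.Kerr.region (0 : ℝ) R → Z.carrier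
  /-- The global clock. -/
  t : Z.carrier → ℝ
  /-- The clock-normalised generator field of the horizon (extended smoothly near it). -/
  L : Π x : Z.carrier, TangentSpace (𝓡 4) x
  mass_nonneg : 0 ≤ M
  lt_R : max (2 * M) 0 < R
  isRicciFlat : ∀ [Z.metric.toPseudoRiemannianMetric.HasLeviCivita], Z.metric.toPseudoRiemannianMetric.IsRicciFlat
  isGloballyHyperbolic : Z.metric.IsGloballyHyperbolic Z.timeOrientation
  subset_chronologicalFuture : (Set.univ : Set Z.carrier) ⊆ Z.metric.chronologicalFuture Z.timeOrientation (Set.range Φ)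
  isLocalDiffeomorph_far : IsLocalDiffeomorph 𝓘(ℝ, Literature.Geometry.Lorentzian.E4) (𝓡 4) (⊤ : ℕ∞) Φ
  injective_far : Function.Injective Φ
  far_bounds : ∀ k : ℕ, ∃ C : ℝ, ∀ m ≤ k, ∀ x : Literature.Geometry.Lorentzian.Kerr.region (0 : ℝ) R, ‖iteratedFDeriv ℝ m (Z.deviationExtend (farBackground M R) Φ) x.1‖ * Literature.Geometry.Lorentzian.Kerr.radius 0 x.1 ≤ C
  far_nonradiating : ∀ (m : ℕ), ∀ δ > (0 : ℝ), ∃ R' : ℝ, ∀ x : Literature.Geometry.Lorentzian.Kerr.region (0 : ℝ) R, R' < Literature.Geometry.Lorentzian.Kerr.radius 0 x.1 → ‖iteratedFDeriv ℝ m (fun y ↦ fderiv ℝ (Z.deviationExtend (farBackground M R) Φ) y (Literature.Geometry.Lorentzian.E4.basisVector 0)) x.1‖ * Literature.Geometry.Lorentzian.Kerr.radius 0 x.1 ≤ δ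
  far_clock : ∀ x : Literature.Geometry.Lorentzian.Kerr.region (0 : ℝ) R, t (Φ x) = x.1 0
  contMDiff_clock : ContMDiff (𝓡 4) 𝓘(ℝ, ℝ) (⊤ : ℕ∞) t
  tame : ∀ k : ℕ, ∃ r₀ : ℝ, 0 < r₀ ∧ ∃ Λ : NNReal, ∀ q ∈ closure (Z.docOfEnd (Set.range Φ)), TameClockChartAt Z t k r₀ Λ q
  basepoint_mem : z ∈ closure (Z.docOfEnd (Set.range Φ))
  contMDiffOn_generator : ∃ 𝒩 : Set Z.carrier, IsOpen 𝒩 ∧ Z.futureEventHorizonOfEnd (Set.range Φ) ⊆ 𝒩 ∧ ContMDiffOn (𝓡 4) ((𝓡 4).prod 𝓘(ℝ, Literature.Geometry.Lorentzian.E4)) (⊤ : ℕ∞) (fun x ↦ (Bundle.TotalSpace.mk' Literature.Geometry.Lorentzian.E4 x (L x) : TangentBundle (𝓡 4) Z.carrier)) 𝒩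
  generator_null : ∀ p ∈ Z.futureEventHorizonOfEnd (Set.range Φ), Z.metric.IsNull (L p) ∧ Z.timeOrientation.IsFutureDirected (L p) ∧ mvfderiv (𝓡 4) t p (L p) = 1
  generator_tangent : ∀ γ : ℝ → Z.carrier, IsMIntegralCurve γ L → γ 0 ∈ Z.futureEventHorizonOfEnd (Set.range Φ) → ∀ s : ℝ, γ s ∈ Z.futureEventHorizonOfEnd (Set.range Φ)
  generator_complete : ∀ p ∈ Z.futureEventHorizonOfEnd (Set.range Φ), ∃ γ : ℝ → Z.carrier, IsMIntegralCurve γ L ∧ γ 0 = p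
  horizon_regular : ∃ (𝒩 : Set Z.carrier) (f : Z.carrier → ℝ), IsOpen 𝒩 ∧ Z.futureEventHorizonOfEnd (Set.range Φ) ⊆ 𝒩 ∧ ContMDiffOn (𝓡 4) 𝓘(ℝ, ℝ) (⊤ : ℕ∞) f 𝒩 ∧ Z.futureEventHorizonOfEnd (Set.range Φ) = {p | p ∈ 𝒩 ∧ f p = 0} ∧ ∀ p ∈ Z.futureEventHorizonOfEnd (Set.range Φ), ∀ v : TangentSpace (𝓡 4) p, mfderiv (𝓡 4) 𝓘(ℝ, ℝ) f p v = 0 ↔ Z.metric.val p v (L p) = 0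
  isCompact_horizonSlice : ∀ c : ℝ, IsCompact (Z.futureEventHorizonOfEnd (Set.range Φ) ∩ {p | t p = c})
  nonexpanding : ∀ [Z.metric.toPseudoRiemannianMetric.HasLeviCivita], ∀ p ∈ Z.futureEventHorizonOfEnd (Set.range Φ), ∀ v w : TangentSpace (𝓡 4) p, Z.metric.val p v (L p) = 0 → Z.metric.val p w (L p) = 0 → Z.metric.val p (Z.metric.leviCivita L p v) w + Z.metric.val p v (Z.metric.leviCivita L p w) = 0

namespace TameEternalLimit

variable (E : TameEternalLimit)

/-- The domain of outer communications `⟨⟨Φ⟩⟩ = I⁺(range Φ) ∩ I⁻(range Φ)` of the far end of the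
limit. [cite: Wald1984, §12.1] -/
def doc : Set E.Z.carrier := E.Z.docOfEnd (Set.range E.Φ)

/-- The future event horizon `𝓗 = ∂I⁻(range Φ) ∩ I⁺(range Φ)` of the far end of the limit
(possibly empty). [cite: HawkingEllis1973, §9.2] -/
def horizon : Set E.Z.carrier := E.Z.futureEventHorizonOfEnd (Set.range E.Φ)

/-- The far-zone deviation `h = Φ^* g − g_{M,0}` (extended by zero off the cylinder), the `let h` of
`FarZoneEternalPapapetrou`. [cite: arXiv210408222, §1] -/
def farDeviation : Literature.Geometry.Lorentzian.E4 → Literature.Geometry.Lorentzian.E4 →L[ℝ] Literature.Geometry.Lorentzian.E4 →L[ℝ] ℝ :=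
  E.Z.deviationExtend (farBackground E.M E.R) E.Φ

/-- **The limit horizon is red-shifted with surface gravity `κ₀` in the tame frame**: the
clock-normalised generator `L` admits a TAME RENORMALISATION `L' = φ L` — `φ` smooth near `𝓗` and
pinched between two positive constants on `𝓗` — which is pregeodesic with CONSTANT non-affinity
`κ₀`: `∇_{L'} L' = κ₀ L'` on `𝓗`.  This is the clock-robust form of "surface gravity bounded below in
the normalisation `dt(L) = 1`" (`LorentzianMetric.HasSurfaceGravityGe` for THE clock `t` of the
structure, no existential over clocks: triage r1-1/r1-2): two admissible tame clocks differ by a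
reparametrisation with bounded positive derivative, under which a pointwise floor `κ ≥ κ₀` is not
invariant but the existence of a bounded renormalisation to constant `κ₀ > 0` is (it says that the
affine parameter grows exponentially in tame time, two-sidedly); given a pointwise floor and ceiling,
`φ = κ₀ ∫_{-∞}^{s} e^{-∫_σ^s κ} dσ` is the bounded solution of `Lφ + κφ = κ₀`.  A degenerate (cold)
horizon admits no such `φ` (`φ` would grow linearly).  Vacuous when `𝓗 = ∅`.
[cite: DafermosRodnianski2008, §7.1 Thm. 7.1 and §3.3.2 Prop. 3.3.1] [cite: Wald1984, §12.5] -/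
def RedShifted [E.Z.metric.toPseudoRiemannianMetric.HasLeviCivita] (κ₀ : ℝ) : Prop :=
  ∃ (φ : E.Z.carrier → ℝ) (c : ℝ), 0 < c ∧ (∃ 𝒩 : Set E.Z.carrier, IsOpen 𝒩 ∧ E.horizon ⊆ 𝒩 ∧ ContMDiffOn (𝓡 4) 𝓘(ℝ, ℝ) (⊤ : ℕ∞) φ 𝒩) ∧ (∀ p ∈ E.horizon, c⁻¹ ≤ φ p ∧ φ p ≤ c) ∧ ∀ p ∈ E.horizon, E.Z.metric.leviCivita (fun x ↦ φ x • E.L x) p (φ p • E.L p) = κ₀ • (φ p • E.L p)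

/-- **An early Killing collar**: a vector field `K`, smooth and Killing
(`g(∇_v K, w) + g(v, ∇_w K) = 0`) on an open set `U` containing the EARLY horizon
`𝓗 ∩ {t < t₁}`, and positively proportional to the generator `L` there (so `𝓗 ∩ {t < t₁}` is a
Killing horizon portion of `K`).  Vacuous when `𝓗 = ∅`.  This is the conclusion of
Alexakis–Ionescu–Klainerman's Hawking rigidity without analyticity applied at the limit bifurcation
sphere (arXiv:0902.1173, Thm 1.1: a Killing field on a neighbourhood of `S`, tangent to the
generators) read back inside `Z`. [cite: AlexakisIonescuKlainerman2009] -/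
def HasEarlyKillingCollar [E.Z.metric.toPseudoRiemannianMetric.HasLeviCivita] : Prop :=
  ∃ (t₁ : ℝ) (U : Set E.Z.carrier) (K : Π x : E.Z.carrier, TangentSpace (𝓡 4) x), IsOpen U ∧ E.horizon ∩ {p | E.t p < t₁} ⊆ U ∧ ContMDiffOn (𝓡 4) ((𝓡 4).prod 𝓘(ℝ, Literature.Geometry.Lorentzian.E4)) (⊤ : ℕ∞) (fun x ↦ (Bundle.TotalSpace.mk' Literature.Geometry.Lorentzian.E4 x (K x) : TangentBundle (𝓡 4) E.Z.carrier)) U ∧ (∀ x ∈ U, ∀ v w : TangentSpace (𝓡 4) x, E.Z.metric.val x (E.Z.metric.leviCivita K x v) w + E.Z.metric.val x v (E.Z.metric.leviCivita K x w) = 0) ∧ ∀ p ∈ E.horizon ∩ {p | E.t p < t₁}, ∃ c : ℝ, 0 < c ∧ K p = c • E.L p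

/-- **The far end is stationary near infinity**: verbatim the CONCLUSION of `FarZoneEternalPapapetrou`
for the limit's far chart — on some `{r > R₁}` of the far cylinder the pulled-back metric
`G = g_{M,0} + h` admits a smooth coordinate vector field `T` with `G(T,T) < 0` and `𝓛_T G = 0`
(coordinate Killing equation). [cite: AlexakisSchlue2018, Thm 1.2] -/
def FarStationary : Prop :=
  ∃ (R₁ : ℝ) (T : Literature.Geometry.Lorentzian.E4 → Literature.Geometry.Lorentzian.E4), E.R ≤ R₁ ∧ ContDiffOn ℝ (⊤ : ℕ∞) T {y | R₁ < Literature.Geometry.Lorentzian.Kerr.radius 0 y} ∧ ∀ y : Literature.Geometry.Lorentzian.E4, R₁ < Literature.Geometry.Lorentzian.Kerr.radius 0 y → (E.farDeviation y + Literature.Geometry.Lorentzian.Kerr.bilin E.M 0 y) (T y) (T y) < 0 ∧ ∀ v w : Literature.Geometry.Lorentzian.E4, (fderiv ℝ (fun z ↦ E.farDeviation z + Literature.Geometry.Lorentzian.Kerr.bilin E.M 0 z) y (T y)) v w + (E.farDeviation y + Literature.Geometry.Lorentzian.Kerr.bilin E.M 0 y) (fderiv ℝ T y v) w + (E.farDeviation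 y + Literature.Geometry.Lorentzian.Kerr.bilin E.M 0 y) v (fderiv ℝ T y w) = 0

/-- **The limit is a (sub-extremal) Kerr black hole**: there are parameters `0 < M'`, `|a| < M'`, an
inner radius `r₁ < r₊(M', a)` and a smooth open embedding `Ψ` of the horizon-penetrating ingoing
Kerr–Schild region `{r > max r₁ 0}` into `Z` which is an ISOMETRY onto its image
(`Ψ^* g_Z = g_{M',a}` pointwise: zero deviation from the Kerr–Schild background) and whose image
covers the closure of the limit's d.o.c. (d.o.c. ∪ horizon).  The Kerr exterior with a collar across
`𝓗⁺`, as the endgame consumes it. [cite: ChruscielCosta2008, Thm. 1.3] -/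
def IsKerrBlackHole : Prop :=
  ∃ (M' a r₁ : ℝ), 0 < M' ∧ |a| < M' ∧ r₁ < Literature.Geometry.Lorentzian.Kerr.rPlus M' a ∧ ∃ Ψ : Literature.Geometry.Lorentzian.Kerr.region a r₁ → E.Z.carrier, ContMDiff 𝓘(ℝ, Literature.Geometry.Lorentzian.E4) (𝓡 4) (⊤ : ℕ∞) Ψ ∧ Topology.IsOpenEmbedding Ψ ∧ closure E.doc ⊆ Set.range Ψ ∧ ∀ x : Literature.Geometry.Lorentzian.Kerr.region a r₁, E.Z.deviation ⟨Literature.Geometry.Lorentzian.Kerr.region a r₁, Literature.Geometry.Lorentzian.Kerr.bilin M' a, fun y ↦ y 0, Literature.Geometry.Lorentzian.Kerr.radius a⟩ Ψ x = 0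

/-- **The limit is flat** (the horizonless outcome): the Levi-Civita connection of `Z` has vanishing
curvature. [cite: Anderson2000, Thm 0.1] -/
def IsFlat [E.Z.metric.toPseudoRiemannianMetric.HasLeviCivita] : Prop :=
  E.Z.metric.leviCivita.IsFlat

section Arises

variable {X : Type} [TopologicalSpace X] [ChartedSpace Literature.Geometry.Lorentzian.E3 X]
  [IsManifold (modelWithCornersSelf ℝ Literature.Geometry.Lorentzian.E3) ((⊤ : ℕ∞) : WithTop ℕ∞) X]
  [ConnectedSpace X] {D : Literature.Geometry.Lorentzian.InitialDataSet (modelWithCornersSelf ℝ Literature.Geometry.Lorentzian.E3) X}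

/-- **`E` is an ω-limit of the development `𝒟` along the base points `p`**: the constant sequence
`(𝒟, p n)` subconverges to `(Z, z)` in the pointed `C²_loc` (Cheeger–Gromov) sense TOGETHER WITH far
charts — some far charts `Φₙ : ℝ × {|x| > R} → 𝒟` of the development converge through the
comparison embeddings to the limit's far chart `Φ`
(`Spacetime.SubconvergesLocallyWithFarChartsTo`, `SpacetimeLocalConvergence.lean`).
[cite: Petersen2006, Ch. 10 §3.2] [cite: Anderson2004, Def. 1.1] -/
def ArisesFrom (𝒟 : Literature.Geometry.Lorentzian.VacuumCauchyDevelopment D) (p : ℕ → 𝒟.carrier) : Prop :=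
  ∃ Φₙ : ℕ → Literature.Geometry.Lorentzian.Kerr.region (0 : ℝ) E.R → 𝒟.carrier,
    Literature.Geometry.Lorentzian.Spacetime.SubconvergesLocallyWithFarChartsTo (fun _ ↦ 𝒟.toSpacetime) p E.Z E.z 2 (farBackground E.M E.R) Φₙ E.Φ

end Arises

end TameEternalLimit

/-! ## §2 The seven registered stubs -/

/-- **S1 · structure of ω-limits of tame developments** (`stub_omegaLimits`; card `OmegaLimits`).
For an MGHD of admissible data with complete `𝓘⁺` and `C³`-tame outer region (hypothesis (ii)), along
every ESCAPING sequence of base points of the outer region (time-separation from `Σ` → ∞) there is a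
`TameEternalLimit` arising from it: pointed `C²_loc` subconvergence with eternal far charts to a
smooth, Ricci-flat, globally hyperbolic limit with the far/clock/tameness/horizon package of the
structure.  Internal cuts (for the lead; each a classical input): (a) COMPACTNESS — Arzelà–Ascoli in
the `C³`-bounded charts of (ii) gives pointed `C^{2,α}_loc` sublimits; (b) REGULARITY — the limit is
smooth and `C^k`-tame for every `k` (this is where triage objection X2 lives: it does NOT follow from
`C³` by compactness; it is the regularity face of rigidity, strictly weaker than the line's conclusion,
and becomes free if the route restates (ii) at all orders — recommended in the line card); (c) TAME
CLOCK — a temporal function with pinched gradient glued from the chart times, charts re-adapted to it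
(card 6's gap α); (d) FAR ZONE — exterior stability / peeling on `{r > R}` (Klainerman–Nicolò) gives
eternal far charts with `‖D^m h‖ r ≤ C`; zero news to the future from the Bondi mass-loss budget and
no incoming radiation at late advanced time (Fatou) give two-sided non-radiation at order `1/r`;
(e) HORIZON — complete `𝓘⁺` + the area theorem (Chruściel–Delay–Galloway–Howard gr-qc/0001003
Thm 1.1) + a horizon AREA BOUND (triage X3; tree: `PenroseHorizonAreaBound`) make the limit horizon
non-expanding, hence shear-free in vacuum (Raychaudhuri), smooth and eternal, with generator field
normalised by the clock; (f) vacuum passes to `C²` limits; the limit d.o.c. is globally hyperbolic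
(maximality).  Why plausibly true: (a),(c),(d),(f) are soft; (e) is the area law plus a Penrose-type
bound; (b) is the one conjectural conjunct and is named as such.  Size XL (splittable (a–f)).
Leans on: `Spacetime.SubconvergesLocallyWithFarChartsTo`, `LocalSubconvergence.FarChartsConverge`
(`norm_iteratedFDeriv_mul_le`: far bounds are inherited by limits — proved),
`LateTimeOmegaLimitSet.lean`, `EventHorizonAreaLaw.lean` (`IsFutureHorizon`, CDGH vocabulary),
`NullConeGeneratorKinematics.lean` (`expansion`, `shearNormSq`), `BondiNewsFlux.lean`,
`KerrDecayHierarchy`/`WeightedNorms` for the far symbols. -/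
theorem stub_omegaLimits :
    ∀ (X : Type) [TopologicalSpace X] [ChartedSpace Literature.Geometry.Lorentzian.E3 X] [IsManifold (modelWithCornersSelf ℝ Literature.Geometry.Lorentzian.E3) ((⊤ : ℕ∞) : WithTop ℕ∞) X] [T2Space X] [SecondCountableTopology X] [ConnectedSpace X], ∀ D ∈ Literature.Geometry.Lorentzian.admissibleVacuumData X, ∀ 𝒟 : Literature.Geometry.Lorentzian.VacuumCauchyDevelopment D, 𝒟.IsMaximal → _root_.Summit.FinalStateConjecture.HasCompleteNullInfinity 𝒟.toCauchyDevelopment → TameOuterRegion 𝒟 →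
      ∀ [𝒟.metric.HasLeviCivita], ∀ p : ℕ → 𝒟.carrier, (∀ n, p n ∈ outerRegion 𝒟.toCauchyDevelopment) → IsEscaping 𝒟.toCauchyDevelopment p →
        ∃ E : TameEternalLimit, E.ArisesFrom 𝒟 p := by
  sorry

/-- **S2 · the κ-floor** (`stub_kappaFloor`; card `KappaFloor`; triage X1, stated as the honest open
step it is).  For a development as in S1 which moreover has NO EXTREMAL REMNANT (hypothesis (i)), every
`TameEternalLimit` arising from it along an escaping sequence of the outer region has a RED-SHIFTED
horizon in the tame clock: `∇_L L = κ L` with `κ ≥ κ₀ > 0` on `𝓗` (`TameEternalLimit.RedShifted`;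
vacuous for horizonless limits).  Mechanism: a limit horizon on which the clock-normalised
non-affinity has no positive floor yields (sub-limit + bounded tame renormalisation
`f = κ₀∫_{-∞}^v e^{-∫κ}`) a COLD eternal tame non-expanding vacuum horizon; there the transversal jet
transport has no damping, `J_k(s) = J_k(0) + s·F_k`, and two-sided boundedness forces `F_k = 0`: the
cold horizon is an extremal ISOLATED horizon to all orders, its near-horizon geometry solves the
vacuum NHG equation on `S²` and is the extremal Kerr throat (Dunajski–Lucietti arXiv:2306.17512;
Chruściel–Reall–Tod), and transverse rigidity (Li–Lucietti) pins the next jets; promotion to `C²`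
convergence of near-zone slabs to extremal Kerr then contradicts (i).  Why it might fail / size: the
last promotion is unique continuation off a DEGENERATE horizon (no bifurcation sphere; Aretakis
growth transversally) — open and possibly false; the planner-facing remedy that removes this stub is
to restate (i) as `CauchyDevelopment.HasEventuallyRedShiftedHorizon` (stronger hypothesis, weaker
crux, `closes` unaffected).  Size XL.  Leans on: `LorentzianMetric.HasSurfaceGravityGe`,
`CauchyDevelopment.HasEventuallyRedShiftedHorizon` (`RedShiftedHorizon.lean`),
`Literature.Barriers.FinalStateConjecture.ExtremalHorizonInstability*` (what fails at `κ = 0`),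
`KerrSurfaceGravity.lean`, `HomotheticSurfaceGravity.lean`. -/
theorem stub_kappaFloor :
    ∀ (X : Type) [TopologicalSpace X] [ChartedSpace Literature.Geometry.Lorentzian.E3 X] [IsManifold (modelWithCornersSelf ℝ Literature.Geometry.Lorentzian.E3) ((⊤ : ℕ∞) : WithTop ℕ∞) X] [T2Space X] [SecondCountableTopology X] [ConnectedSpace X], ∀ D ∈ Literature.Geometry.Lorentzian.admissibleVacuumData X, ∀ 𝒟 : Literature.Geometry.Lorentzian.VacuumCauchyDevelopment D, 𝒟.IsMaximal → _root_.Summit.FinalStateConjecture.HasCompleteNullInfinity 𝒟.toCauchyDevelopment → NoExtremalRemnant 𝒟 → TameOuterRegion 𝒟 →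
      ∀ [𝒟.metric.HasLeviCivita], ∀ p : ℕ → 𝒟.carrier, (∀ n, p n ∈ outerRegion 𝒟.toCauchyDevelopment) → IsEscaping 𝒟.toCauchyDevelopment p →
        ∀ (E : TameEternalLimit) [E.Z.metric.toPseudoRiemannianMetric.HasLeviCivita], E.ArisesFrom 𝒟 p →
          ∃ κ₀ : ℝ, 0 < κ₀ ∧ E.RedShifted κ₀ := by
  sorry

/-- **S3 · THE LEVER: an eternal, tame, red-shifted, non-expanding vacuum horizon is a Killing
horizon near its early end** (`stub_killingCollar`; card `EternalRedShiftKillingCollar`, SHARPENED by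
the three triage notes: the horizon is the genuine event horizon of an asymptotically flat far end —
a null hypersurface with complete generator flow, not an arbitrary closed `L`-invariant set, which
kills the sandwich-plane-wave / single-geodesic junk instances; the clock is tied to the tame charts
by `TameClockChartAt`; tameness is available at every order; the conclusion is an EARLY collar
`{t < t₁}` only, which is all AIK's local theorem gives).  Statement: for every `TameEternalLimit` and
`κ₀ > 0` with `RedShifted κ₀`, `HasEarlyKillingCollar`.  Mechanism: (1) renormalise `L` to constant
non-affinity `κ₀` by a bounded positive `f` (two-sided ODE along complete generators); (2) in Gaussian
null coordinates along `𝓗` the transversal jets obey `(∂_s + kκ₀)J_k = F_k(lower jets)` (vacuum NEH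
hierarchy, Friedrich–Rácz–Wald gr-qc/9811021 §3, Hollands–Ishibashi–Wald gr-qc/0605106) whose
homogeneous modes `e^{-kκ₀s}` blow up as `s → -∞`, so two-sided `C^k`-boundedness (tameness of the
ETERNAL limit, both time directions) forces every available jet to be stationary along the
generators; (3) Kruskalise (`V = e^{κ₀s}`, `U = ρe^{-κ₀s}`): with jets stationary to order `k` the
boost-renormalised past completion is a `C^{⌊k/2⌋}` regular BIFURCATE non-expanding horizon (triage
r1-3 §A1 computation; `k` is at our disposal since the limit is tame at every order); (4) AIK,
Hawking's local rigidity without analyticity (arXiv:0902.1173 Thm 1.1: local, regular, bifurcate,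
non-expanding `(S, N, N̲)` in a smooth vacuum spacetime ⇒ a Killing field on a neighbourhood of `S`
tangent to both generators; no stationarity, no compactness, nothing global) gives `K` near `S`,
i.e. on a neighbourhood in `Z` of `𝓗 ∩ {t < t₁}`.  Why it might fail: AIK is printed for `C^∞` and
consumes finitely many (unstated) derivatives — the finite-`k` version of their Carleman step must be
extracted; an undamped free datum at some order of the nonlinear NEH tower (card's falsifier (1),
to be checked against Lewandowski–Pawłowski) would kill step (2).  Linear shadow TRUE (triage r1-3:
an eternal `C¹`-bounded wave on Schwarzschild with zero horizon flux is static in a collar).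
Size L–XL.  Leans on: `KillingHorizonShadowAlong.lean` (`IsKillingFieldOn`), `KillingDefect.lean`,
`NullConeGeneratorKinematics.lean`, `Literature.Barriers.FinalStateConjecture.KillingExtensionObstruction`
(evasion (2): bifurcate AIK is outside the Ionescu–Klainerman non-extension class), Mathlib
`IsMIntegralCurve`, `Mathlib.Analysis.ODE.Gronwall` (the scalar transient lemma). -/
theorem stub_killingCollar :
    ∀ (E : TameEternalLimit) [E.Z.metric.toPseudoRiemannianMetric.HasLeviCivita] (κ₀ : ℝ), 0 < κ₀ → E.RedShifted κ₀ →
      E.HasEarlyKillingCollar := by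
  sorry

/-- **S4 · far-zone eternal Papapetrou** (`stub_farZoneEternalPapapetrou`) — LITERALLY the typed crux
`FarZoneEternalPapapetrou` of route `EternalPapapetrou` (stmt-FinalStateConjecture-10034; one item,
staffed once, shared by both routes): at some finite order `k`, an eternal far chart with `1/r` bounds
which is two-sided non-radiating at order `1/r` is stationary near infinity (a timelike coordinate
Killing field `T` on some `{r > R₁}`, no inner boundary condition).  Applied to the limit's far chart
by `farStationary_of` below (proved).  Why it might fail: as recorded on stmt-10034 (known
non-radiating ⇒ stationary theorems need periodicity or a full expansion at `𝓘`: Alexakis–Schlue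
arXiv:1504.04592 Thm 1.2/1.3, Bičák–Scholtz–Tod).  Size XL. [cite: AlexakisSchlue2018, Thm 1.2] -/
theorem stub_farZoneEternalPapapetrou : FarZoneEternalPapapetrou := by
  sorry

/-- **S5 · the collar handshake (black-hole branch)** (`stub_collarHandshake`; card `CollarHandshake`,
absorbing the merged idea photon-wall-pincer per triage r1-2).  A `TameEternalLimit` with NONEMPTY
horizon, red-shifted (`κ₀ > 0`), carrying an early Killing collar `K` and a far stationary `T`, is a
sub-extremal Kerr black hole in the sense of `IsKerrBlackHole` (an isometric horizon-penetrating
Kerr–Schild chart covering the closure of its d.o.c.).  Mechanism (run on EARLY slabs, triage r1-3):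
continue `T` inward while it stays timelike (Müller zum Hagen analyticity + Nomizu, or
`T`-conditional Carleman: Alexakis–Ionescu–Klainerman arXiv:0904.0982) and `K` outward across
`K`-conditionally pseudo-convex leaves (Ionescu–Klainerman arXiv:1108.3575 Def 1.1/Thm 1.2; the
`K`-orthogonal = superradiant-threshold null geodesics are untrapped near a non-degenerate horizon);
on the overlap `span{T, K}` is a `2`-dimensional Killing algebra of an AF vacuum end ⇒ axisymmetry
(Beig–Chruściel gr-qc/9510015) ⇒ Kerr by smooth stationary-axisymmetric uniqueness (Chruściel–Costa
arXiv:0806.0016 Thm 1.3), or `T ∥ K` ⇒ static ⇒ Schwarzschild (Sudarsky–Wald; Bunting–Masood); the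
isometry with Kerr on an early slab of the d.o.c. propagates to the whole d.o.c. of the globally
hyperbolic limit by vacuum Cauchy uniqueness, and across `𝓗` into a collar by the red-shift region.
Sub-extremality: `κ₀ > 0`.  Why it might fail: THE BELT — for rapidly rotating limits the inward
`T`-sweep (stops at the ergosurface) and the outward `K`-sweep (stops at the threshold perihelion)
need not meet (on exact Kerr they meet iff `|a|/M < √(2√2 − 2) ≈ 0.910`, card numerics
`compute/threshold_rays.py`); closing the belt is the AIK conjecture territory shared with
BeltLiouville's `SmoothHawkingRigidity` (stmt-10441) and `BeltKillingLiouville` (stmt-10442).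
Size XL.  Leans on: `StationaryAFBlackHole`, `docOfEnd`/`futureEventHorizonOfEnd` (`Stationary.lean`),
`AxisymmetricBlackHoleUniqueness.lean`, `StaticBlackHoleUniqueness.lean`,
`KillingFieldAnalyticExtension.lean` (`IsKillingField.exists_extension_self`),
`MullerZumHagenAnalyticity.lean`, `NomizuKillingExtension.lean`, `MGHDUniqueness.lean`,
`Literature.Barriers.FinalStateConjecture.KillingExtensionObstruction` (evasions (5)–(6), scope (g)). -/
theorem stub_collarHandshake :
    ∀ (E : TameEternalLimit) [E.Z.metric.toPseudoRiemannianMetric.HasLeviCivita], E.horizon.Nonempty →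
      (∃ κ₀ : ℝ, 0 < κ₀ ∧ E.RedShifted κ₀) → E.HasEarlyKillingCollar → E.FarStationary → E.IsKerrBlackHole := by
  sorry

/-- **S6 · no tame vacuum geon (horizonless branch)** (`stub_noTameGeon`).  A `TameEternalLimit` with
EMPTY horizon (everything it contains is visible from the far end, `Z ⊆ I⁺(range Φ)` being part of
the structure) and a far stationary `T` is FLAT.  This is NOT this line's mechanism (the lever needs a
horizon); it is the shared "large-data no-geon" input of every ω-limit line, here in its cleanest
form — eternal, tame at all orders, vacuum, two-sided non-radiating, already stationary near infinity
— i.e. the complete case of `EternalStationaryExteriorIsKerr` (stmt-10745, route EternalPapapetrou)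
and the stationary core of `NoVacuumBreathers` (stmt-9980/10029).  Mechanism: extend `T` inward
(elliptic unique continuation where `T` is timelike; the obstruction is a trapped null geodesic of a
horizonless core, Alexakis–Schlue Remark p. 4), then a globally stationary geodesically complete
vacuum spacetime is flat (Anderson, `Anderson2000_stationaryVacuum_flat` /
`CompleteStationaryVacuumFlat.lean`; Lichnerowicz).  Why it might fail: the inward extension through
a possibly trapping horizonless core is the Ionescu–Klainerman problem; a smooth AF vacuum geon,
eternal and tame, refutes it (none is known).  Size XL (shared).  Leans on:
`StationaryVacuumRigidity.lean`, `CompleteStationaryVacuumFlat.lean`,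
`KillingFieldAnalyticExtension.lean`, stmt-10745 / stmt-10029 by name for staffing. -/
theorem stub_noTameGeon :
    ∀ (E : TameEternalLimit) [E.Z.metric.toPseudoRiemannianMetric.HasLeviCivita], E.horizon = ∅ →
      E.FarStationary → E.IsFlat := by
  sorry

/-- **S7 · the tame endgame** (`stub_tameEndgame`; card `TameEndgame`; the frame of the line).  If
along EVERY escaping sequence of base points of the outer region of an MGHD with complete `𝓘⁺` and
`C³`-tame outer region there is a `TameEternalLimit` arising from it which is a (sub-extremal) Kerr
black hole or flat, then the honest exhaustive decomposition exists: `∃ O d, O = exteriorOf 𝒟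
d.charted ∧ HasExhaustiveCharts d` (a `FinalStateDecomposition … O 2`).  Mechanism: (1) parameters
freeze — the Kerr parameters `(M, a, boost)` of limits are locally constant in the base point
(overlapping limits), the Bondi mass-loss and horizon-area budgets are finite, so along the whole
flow finitely many holes (curvature quantum `m₀(Λ)` from (ii): Kretschmann `≥ 3/(4M⁴)` at a Kerr
horizon vs `≤ C(Λ)` in a tame ball; total mass bounded) with converging parameters and asymptotically
inertial, sublinearly separating motions remain; (2) charts — horizon-anchored near-zone charts
(time = Kerr-star time of the limit charts transported by the comparison embeddings of
`LocalSubconvergence`, radius from the Kerr chart) and a flat radiation-zone chart; `C²` convergence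
on truncated slabs and flat slabs is exactly the `C²_loc` convergence of translates plus the far
`1/r` bounds; (3) `O = exteriorOf 𝒟 d.charted` and `HasExhaustiveCharts` — chart time agrees with
causal order on `O`, near zones reach the horizons (collar), no annulus is left (far charts overlap
near zones).  Why it might fail: parameters might DRIFT without converging although every limit is
exactly Kerr (needs integrability of the absorbed angular-momentum/energy fluxes, i.e. the area bound
again); the flat chart's sup-norm convergence on unbounded slabs needs uniformity near `i⁰` (supplied
by asymptotic flatness of the data and domain of dependence).  Size L–XL (bookkeeping + modulation;
the analogue of `LaSalleTransfer` (iv), stmt-10037, and of `FinalStateFromRigidity`, stmt-10014).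
Leans on: `FinalStateDecomposition` API (`KerrConvergence.lean`), `StationaryFinalStateDecomposition
.toFinalStateDecomposition`, `QuasiFinalStateDecomposition` (ε-form for the modulation step),
`AsymptoticallyStationaryExhaustion.lean`, `Summit.FinalStateConjecture.certifiedLate/certifiedSlab`,
`BondiMass`/`BondiNewsFlux`, `EventHorizonAreaLaw`. -/
theorem stub_tameEndgame :
    ∀ (X : Type) [TopologicalSpace X] [ChartedSpace Literature.Geometry.Lorentzian.E3 X] [IsManifold (modelWithCornersSelf ℝ Literature.Geometry.Lorentzian.E3) ((⊤ : ℕ∞) : WithTop ℕ∞) X] [T2Space X] [SecondCountableTopology X] [ConnectedSpace X], ∀ D ∈ Literature.Geometry.Lorentzian.admissibleVacuumData X, ∀ 𝒟 : Literature.Geometry.Lorentzian.VacuumCauchyDevelopment D, 𝒟.IsMaximal → _root_.Summit.FinalStateConjecture.HasCompleteNullInfinity 𝒟.toCauchyDevelopment → TameOuterRegion 𝒟 →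
      (∀ [𝒟.metric.HasLeviCivita], ∀ p : ℕ → 𝒟.carrier, (∀ n, p n ∈ outerRegion 𝒟.toCauchyDevelopment) → IsEscaping 𝒟.toCauchyDevelopment p →
        ∃ E : TameEternalLimit, E.ArisesFrom 𝒟 p ∧ ∀ [E.Z.metric.toPseudoRiemannianMetric.HasLeviCivita], E.IsKerrBlackHole ∨ E.IsFlat) →
      ∃ (O : Set 𝒟.carrier) (d : Literature.Geometry.Lorentzian.FinalStateDecomposition 𝒟.toSpacetime O 2), O = _root_.Summit.FinalStateConjecture.exteriorOf 𝒟.toCauchyDevelopment d.charted ∧ _root_.Summit.FinalStateConjecture.HasExhaustiveCharts d := by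
  sorry

/-! ## §3 Proved glue: the far-zone crux applies to the limit's far chart -/

/-- **`FarZoneEternalPapapetrou` makes every `TameEternalLimit` stationary near infinity** (real
proof: the structure's far package is, at the order `k` chosen by stmt-10034, exactly its hypothesis
list, and `FarStationary` is its conclusion). [folklore] -/
theorem farStationary_of (h : FarZoneEternalPapapetrou) (E : TameEternalLimit)
    [E.Z.metric.toPseudoRiemannianMetric.HasLeviCivita] : E.FarStationary := by
  obtain ⟨k, hk⟩ := h
  obtain ⟨C, hC⟩ := E.far_bounds k
  have hric : E.Z.metric.toPseudoRiemannianMetric.IsRicciFlat := E.isRicciFlat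
  have key := hk E.M E.R C E.mass_nonneg E.lt_R E.Z hric E.Φ E.isLocalDiffeomorph_far E.injective_far
    (fun m hm x ↦ hC m hm x) (fun m _ δ hδ ↦ E.far_nonradiating m δ hδ)
  exact key

/-! ## §4 The composition (kernel-checked, sorry-free) -/

/-- **Composition.** `S1 → S2 → S3 → S4 → S5 → S6 → S7 → Φ`: fix the development; by S7 it suffices
to produce, along every escaping sequence of the outer region, a limit which is Kerr or flat; S1 gives
the limit `E`; S4 (via `farStationary_of`) makes it stationary near infinity; if its horizon is empty,
S6 makes it flat; otherwise S2 gives the κ-floor, S3 the early Killing collar, and S5 the Kerr black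
hole.  The stub statements enter as hypotheses via `type_of%`, so this theorem is closed (axioms
`propext`, `Classical.choice`, `Quot.sound`). [folklore] -/
theorem tameResolution_of
    (h₁ : type_of% stub_omegaLimits)
    (h₂ : type_of% stub_kappaFloor)
    (h₃ : type_of% stub_killingCollar)
    (h₄ : type_of% stub_farZoneEternalPapapetrou)
    (h₅ : type_of% stub_collarHandshake)
    (h₆ : type_of% stub_noTameGeon)
    (h₇ : type_of% stub_tameEndgame) :
    TameResolution := by
  intro X _ _ _ _ _ _ D hD 𝒟 hmax hcomp hyp
  refine h₇ X D hD 𝒟 hmax hcomp hyp.2 ?_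
  intro _ p hp hesc
  obtain ⟨E, hE⟩ := h₁ X D hD 𝒟 hmax hcomp hyp.2 p hp hesc
  refine ⟨E, hE, ?_⟩
  intro _
  have hfar : E.FarStationary := farStationary_of h₄ E
  rcases E.horizon.eq_empty_or_nonempty with h0 | hne
  · exact Or.inr (h₆ E h0 hfar)
  · obtain ⟨κ₀, hκ₀, hred⟩ := h₂ X D hD 𝒟 hmax hcomp hyp.1 hyp.2 p hp hesc E hE
    exact Or.inl (h₅ E hne ⟨κ₀, hκ₀, hred⟩ (h₃ E κ₀ hκ₀ hred) hfar)

/-- **The skeleton's concluding theorem BY NAME**: the seven stub statements imply the crux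
`PhotonSphereChannels.ChannelsResolveTameDevelopments` (type literally the route decl; `K1` is
discarded). [folklore] -/
theorem ChannelsResolveTameDevelopments_of
    (h₁ : type_of% stub_omegaLimits)
    (h₂ : type_of% stub_kappaFloor)
    (h₃ : type_of% stub_killingCollar)
    (h₄ : type_of% stub_farZoneEternalPapapetrou)
    (h₅ : type_of% stub_collarHandshake)
    (h₆ : type_of% stub_noTameGeon)
    (h₇ : type_of% stub_tameEndgame) :
    Summit.FinalStateConjecture.FinalStateConjecture.Theses.PhotonSphereChannels.ChannelsResolveTameDevelopments :=
  channelsResolve_of_tameResolution (tameResolution_of h₁ h₂ h₃ h₄ h₅ h₆ h₇)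

/-- The crux from the stubs themselves (becomes a closed proof of stmt-FinalStateConjecture-10046 once
the seven stubs land). [folklore] -/
theorem channelsResolveTameDevelopments :
    Summit.FinalStateConjecture.FinalStateConjecture.Theses.PhotonSphereChannels.ChannelsResolveTameDevelopments :=
  ChannelsResolveTameDevelopments_of stub_omegaLimits stub_kappaFloor stub_killingCollar
    stub_farZoneEternalPapapetrou stub_collarHandshake stub_noTameGeon stub_tameEndgame

end Summit.FinalStateConjecture.FinalStateConjecture.Cruxes.ChannelsResolveTameDevelopments.LimitBifurcationSphereHawkingCollar

end
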